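import Summits.ValiantsHypothesis.ValiantsHypothesis.Theorems.NcSOSLift
import Summits.ValiantsHypothesis.ValiantsHypothesis.Theorems.NcCayleyDeterminant
import Literature.Computability.AlgebraicComplexity.HWY10SumOfSquares
import Mathlib.Analysis.SpecificLimits.Normed
import HarnessLib

/-!
# `HWY10_thm_1_7` discharged: the padded permanent lift (Hrubeš–Wigderson–Yehudayoff, Lemma C.5, Thm 1.7)

Workshop file for the node `CommutativityDial` (decomp-valiant lens 6; road K5a′, stage 3c of 3), on
top of `NcSOSLift.sos_bilinear_le_lift` (Cor. C.4) and `NcCayleyDeterminant.hasNcCircuitSizeLE_substIn`.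
(1) `perm_lift`: the PADDED lifting substitution `liftSubst r n` (Lemma C.5's `[[z₀I, z₁I], [z₁I, z₀I]]`
on `[0,4r)`, an identity block on `[4r,n)` — ONE substitution for every `n ≥ 4r`) maps `PERM_n` to
`LID_r`: the surviving permutations are the involutions `swapFun e` (`q ↔ partner q` where the
`2r`-periodic extension of `e` is `1`), whose column word is the periodic word of `e`; every other
permutation reads a zero. (2) `sos_bilinear_le_perm`: `B(SOS_{2^r}) ≤ 3·2^r·(4r+1)²·C(PERM_n)`,
`4r ≤ n`, every commutative ring. (3) `key_ineq` (`r = ⌊n/4⌋`): `c·2^{(n-3)ε/4} ≤ 3(n+1)²·s`, and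
`HWY10_thm_1_7_holds`: `2^n ≤ (s+1)^d`, `d = ⌈8/ε⌉₊`, all large `n` — the named fact `HWY10_thm_1_7 K`
for every field `K` (lineage fact table 1 → 0; `Theses/NcSOSRoad` is conditional on the numeric
conjecture `SOSBilinearSuperlinear` only). HONEST FRAMING: theorem in print (HWY STOC 2010 §C = J. AMS
24 (2011) §5), kernel-new formalisation, bookkeeping deltas only; no unconditional bound; `VP ≠ VNP` untouched.
-/

noncomputable section

namespace Summit.ValiantsHypothesis.ValiantsHypothesis.Theorems.NcSOSPermanent

open Literature.Computability.AlgebraicComplexity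
open Summit.ValiantsHypothesis.ValiantsHypothesis.Theorems.NcBlockForms
  Summit.ValiantsHypothesis.ValiantsHypothesis.Theorems.NcSOSLift
  Summit.ValiantsHypothesis.ValiantsHypothesis.Theorems.NcCayleyDeterminant

universe u

variable (F : Type u) [CommRing F]

section Subst

/-- Partner position: `m+2r` if `m<2r`, `m-2r` if `2r≤m<4r`, else `m`. [cite: HrubesWigdersonYehudayoff2010, Lemma C.5] -/
def partner (r m : ℕ) : ℕ := if m < 2 * r then m + 2 * r else if m < 4 * r then m - 2 * r else m

/-- Its three regimes (for `omega`). [cite: HrubesWigdersonYehudayoff2010, Lemma C.5] -/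
theorem partner_eq (r m : ℕ) : (m < 2 * r ∧ partner r m = m + 2 * r) ∨
    (2 * r ≤ m ∧ m < 4 * r ∧ partner r m = m - 2 * r) ∨ (4 * r ≤ m ∧ partner r m = m) := by
  unfold partner; split_ifs <;> omega

/-- The PADDED LIFTING SUBSTITUTION on matrix positions `(row, column)`: `z₀` on the diagonal of
`[0,4r)`, `1` on that of `[4r,n)`, `z₁` at `(partner q, q)`, `q < 4r`, else `0`. [cite: HrubesWigdersonYehudayoff2010, Lemma C.5] -/
def liftSubst (r n : ℕ) (x : Fin n × Fin n) : Fin 2 ⊕ F :=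
  if x.1.val = x.2.val then (if x.2.val < 4 * r then Sum.inl 0 else Sum.inr 1)
  else if x.1.val = partner r x.2.val then Sum.inl 1 else Sum.inr 0

/-- The `2r`-periodic extension of `e : Fin 2r → Fin 2` to `ℕ`. [cite: HrubesWigdersonYehudayoff2010, Lemma C.5] -/
def perExt (r : ℕ) (e : Fin (2 * r) → Fin 2) (m : ℕ) : Fin 2 :=
  if h : 0 < r then e ⟨m % (2 * r), Nat.mod_lt _ (by omega)⟩ else 0

/-- Invariance under `partner` (periodicity). [cite: HrubesWigdersonYehudayoff2010, Lemma C.5] -/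
theorem perExt_partner (r : ℕ) (e : Fin (2 * r) → Fin 2) {m : ℕ} (hm : m < 4 * r) :
    perExt r e (partner r m) = perExt r e m := by
  have hadd : ∀ m, perExt r e (m + 2 * r) = perExt r e m := fun m => by
    unfold perExt; split_ifs with h
    exacts [congrArg e (Fin.ext (by dsimp only; rw [Nat.add_mod_right])), rfl]
  rcases partner_eq r m with h | h | h
  · rw [h.2, hadd]
  · rw [h.2.2, ← hadd (m - 2 * r), Nat.sub_add_cancel h.1]
  · omega

/-- The involution `q ↦ partner q` on the positions `q < 4r` with `e(q mod 2r) = 1`, identity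
elsewhere. [cite: HrubesWigdersonYehudayoff2010, Lemma C.5] -/
def swapFun (r n : ℕ) (hn : 4 * r ≤ n) (e : Fin (2 * r) → Fin 2) (q : Fin n) : Fin n :=
  if q.val < 4 * r ∧ perExt r e q.val = 1 then
    ⟨partner r q.val, by rcases partner_eq r q.val with h | h | h <;> omega⟩ else q

/-- Its value. [cite: HrubesWigdersonYehudayoff2010, Lemma C.5] -/
theorem swapFun_val {r n : ℕ} (hn : 4 * r ≤ n) (e : Fin (2 * r) → Fin 2) (q : Fin n) :
    (swapFun r n hn e q).val =
      if q.val < 4 * r ∧ perExt r e q.val = 1 then partner r q.val else q.val := by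
  unfold swapFun; split_ifs <;> rfl

/-- It is an involution (the permutation `(swapFun_involutive hn e).toPerm`). [cite: HrubesWigdersonYehudayoff2010, Lemma C.5] -/
theorem swapFun_involutive {r n : ℕ} (hn : 4 * r ≤ n) (e : Fin (2 * r) → Fin 2) :
    Function.Involutive (swapFun r n hn e) := by
  intro q; apply Fin.ext; rw [swapFun_val, swapFun_val]
  by_cases h : q.val < 4 * r ∧ perExt r e q.val = 1
  · have h₁ := partner_eq r q.val; have h₂ := partner_eq r (partner r q.val)
    rw [if_pos h, perExt_partner r e h.1, if_pos ⟨by omega, h.2⟩]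
    omega
  · rw [if_neg h, if_neg h]

/-- `e ↦ swapFun e` is injective. [cite: HrubesWigdersonYehudayoff2010, Lemma C.5] -/
theorem toPerm_swapFun_injective {r n : ℕ} (hn : 4 * r ≤ n) :
    Function.Injective fun e : Fin (2 * r) → Fin 2 => (swapFun_involutive hn e).toPerm _ := by
  intro e₁ e₂ h; funext q'; have hq' := q'.isLt
  have hv := congrArg (fun π : Equiv.Perm (Fin n) => (π ⟨q'.val, by omega⟩).val) h
  simp only [Function.Involutive.coe_toPerm, swapFun_val] at hv
  have hp : ∀ e : Fin (2 * r) → Fin 2, perExt r e q'.val = e q' := fun e => by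
    unfold perExt; rw [dif_pos (by omega)]; exact congrArg e (Fin.ext (Nat.mod_eq_of_lt hq'))
  rw [hp e₁, hp e₂] at hv
  have hne : partner r q'.val ≠ q'.val := by have := partner_eq r q'.val; omega
  have h1 := (e₁ q').isLt; have h2 := (e₂ q').isLt; apply Fin.ext
  by_cases ha : e₁ q' = 1 <;> by_cases hb : e₂ q' = 1
  · rw [ha, hb]
  · rw [if_pos ⟨by omega, ha⟩, if_neg (fun h => hb h.2)] at hv; exact absurd hv hne
  · rw [if_neg (fun h => ha h.2), if_pos ⟨by omega, hb⟩] at hv; exact absurd hv.symm hne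
  · rw [Fin.ext_iff, Fin.val_one] at ha hb; omega

/-- **The surviving permutations are the involutions `swapFun e`.**
[cite: HrubesWigdersonYehudayoff2010, Lemma C.5] -/
theorem exists_swapFun_eq {r n : ℕ} (hn : 4 * r ≤ n) (π : Equiv.Perm (Fin n))
    (hgood : ∀ q : Fin n, (π q).val = q.val ∨ (π q).val = partner r q.val) :
    ∃ e : Fin (2 * r) → Fin 2, (swapFun_involutive hn e).toPerm _ = π := by
  obtain ⟨E, hE⟩ : ∃ E : ℕ → Fin 2, ∀ q : Fin n, E q.val = if (π q).val = q.val then 0 else 1 :=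
    ⟨fun m => if h : m < n then (if (π ⟨m, h⟩).val = m then 0 else 1) else 0,
      fun q => by simp only [dif_pos q.isLt, Fin.eta]⟩
  refine ⟨fun q' => E q'.val, Equiv.ext fun q => Fin.ext ?_⟩
  rw [Function.Involutive.coe_toPerm, swapFun_val]
  have hq := q.isLt; have hpq := partner_eq r q.val
  by_cases h4 : q.val < 4 * r
  · -- the representative `q₀ = q mod 2r ∈ {q, partner q}`: `π` moves `q` iff it moves `q₀`
    obtain ⟨q₀, hq₀, hiff⟩ : ∃ q₀ : Fin n, q₀.val = q.val % (2 * r) ∧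
        ((π q).val = q.val ↔ (π q₀).val = q₀.val) := by
      by_cases h2 : q.val < 2 * r
      · exact ⟨q, (Nat.mod_eq_of_lt h2).symm, Iff.rfl⟩
      · obtain ⟨q₀, hq₀⟩ : ∃ q₀ : Fin n, q₀.val = q.val - 2 * r := ⟨⟨_, by omega⟩, rfl⟩
        refine ⟨q₀, by rw [hq₀, Nat.mod_eq_sub_mod (by omega), Nat.mod_eq_of_lt (by omega)], ?_⟩
        have hp₀ := partner_eq r q₀.val; have hg := hgood q; have hg₀ := hgood q₀
        have hinj : (π q).val ≠ (π q₀).val := fun h => by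
          have := congrArg Fin.val (π.injective (Fin.ext h)); omega
        constructor <;> intro h <;> omega
    have hper : perExt r (fun q' : Fin (2 * r) => E q'.val) q.val = E q₀.val := by
      unfold perExt; rw [dif_pos (by omega)]; exact congrArg E hq₀.symm
    rw [hper, hE q₀]
    by_cases hfix : (π q₀).val = q₀.val
    · rw [if_pos hfix, if_neg (fun h => absurd h.2 (by decide))]; exact (hiff.2 hfix).symm
    · rw [if_neg hfix, if_pos ⟨h4, rfl⟩]
      exact (hgood q).elim (fun h => absurd (hiff.1 h) hfix) Eq.symm
  · rw [if_neg (fun h => h4 h.1)]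
    exact (hgood q).elim Eq.symm fun h => by omega

/-- The letters of the column word of `swapFun e` under the substitution: the periodic word of `e`
on `[0, 4r)`, the constant `1` on `[4r, n)`. [cite: HrubesWigdersonYehudayoff2010, Lemma C.5] -/
theorem letter_swapFun {r n : ℕ} (hn : 4 * r ≤ n) (e : Fin (2 * r) → Fin 2) (q : Fin n) :
    ncInputVal (liftSubst F r n (swapFun r n hn e q, q)) =
      if q.val < 4 * r then FreeAlgebra.ι F (perExt r e q.val) else 1 := by
  have hv := swapFun_val hn e q; have hpq := partner_eq r q.val
  unfold liftSubst; dsimp only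
  by_cases hq : q.val < 4 * r
  · rw [if_pos hq, if_pos hq]
    by_cases hE : perExt r e q.val = 1
    · rw [if_pos ⟨hq, hE⟩] at hv
      rw [if_neg (show ¬((swapFun r n hn e q).val = q.val) by omega), if_pos hv, hE]; rfl
    · rw [if_neg (fun h => hE h.2)] at hv
      have h0 : perExt r e q.val = 0 := Fin.ext (by
        have := (perExt r e q.val).isLt; rw [Fin.ext_iff, Fin.val_one] at hE; rw [Fin.val_zero]; omega)
      rw [if_pos hv, h0]; rfl
  · rw [if_neg (fun h => hq h.1)] at hv
    rw [if_pos hv, if_neg hq, if_neg hq]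
    exact map_one (algebraMap F (FreeAlgebra F (Fin 2)))

/-- The column word of `swapFun e` is the periodic word of `e`. [cite: HrubesWigdersonYehudayoff2010, Lemma C.5] -/
theorem word_swapFun {r t : ℕ} (hn : 4 * r ≤ 4 * r + t) (e : Fin (2 * r) → Fin 2) :
    (List.ofFn fun q : Fin (4 * r + t) =>
        ncInputVal (liftSubst F r (4 * r + t) (swapFun r (4 * r + t) hn e q, q))).prod =
      (List.ofFn fun p : Fin (4 * r) => FreeAlgebra.ι F (perExt r e p.val)).prod := by
  rw [List.ofFn_add, List.prod_append,
    ← mul_one (List.ofFn fun p : Fin (4 * r) => FreeAlgebra.ι F (perExt r e p.val)).prod]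
  congr 1
  · exact congrArg List.prod (congrArg List.ofFn (funext fun i => by
      rw [letter_swapFun, if_pos (by rw [Fin.val_castLE]; exact i.isLt)]; try rfl))
  · exact List.prod_eq_one fun x hx => by
      obtain ⟨j, rfl⟩ := List.mem_ofFn.1 hx
      try dsimp only
      rw [letter_swapFun, if_neg (by rw [Fin.val_natAdd]; omega)]

/-- A permutation outside the family reads a zero entry. [cite: HrubesWigdersonYehudayoff2010, Lemma C.5] -/
theorem word_eq_zero_of_bad {r n : ℕ} (π : Equiv.Perm (Fin n))
    (h : ¬ ∀ q : Fin n, (π q).val = q.val ∨ (π q).val = partner r q.val) :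
    (List.ofFn fun q : Fin n => ncInputVal (liftSubst F r n (π q, q))).prod = 0 := by
  obtain ⟨q, hq⟩ := not_forall.1 h
  apply List.prod_eq_zero; rw [List.mem_ofFn]; refine ⟨q, ?_⟩; unfold liftSubst; dsimp only
  rw [if_neg (fun h₁ => hq (Or.inl h₁)), if_neg (fun h₂ => hq (Or.inr h₂))]
  exact map_zero (algebraMap F (FreeAlgebra F (Fin 2)))

/-- **Lemma C.5, padded**: `PERM_n ↦ LID_r` under the lifting substitution, every `n ≥ 4r`.
[cite: HrubesWigdersonYehudayoff2010, Lemma C.5] -/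
theorem perm_lift {r n : ℕ} (hn : 4 * r ≤ n) :
    FreeAlgebra.lift F (fun x => ncInputVal (liftSubst F r n x)) (ncPerPoly F n) = lidPoly F r := by
  classical
  obtain ⟨t, rfl⟩ := Nat.exists_eq_add_of_le hn
  rw [ncPerPoly, map_sum]
  simp only [map_list_prod, List.map_ofFn, Function.comp_def, FreeAlgebra.lift_ι_apply]
  rw [← Finset.sum_subset (Finset.subset_univ (Finset.univ.image fun e : Fin (2 * r) → Fin 2 =>
      (swapFun_involutive hn e).toPerm _)),
    Finset.sum_image fun e₁ _ e₂ _ h => toPerm_swapFun_injective hn h]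
  · unfold lidPoly
    refine Finset.sum_congr rfl fun e _ => ?_
    rw [List.map_ofFn, Function.Involutive.coe_toPerm, word_swapFun]
    refine congrArg List.prod (congrArg List.ofFn (funext fun p => ?_))
    have hr : 0 < r := by have := p.isLt; omega
    simp only [Function.comp_apply, perExt, dif_pos hr]
  · intro π _ hπ; apply word_eq_zero_of_bad; intro hgood
    obtain ⟨e, he⟩ := exists_swapFun_eq hn π hgood
    exact hπ (Finset.mem_image.2 ⟨e, Finset.mem_univ _, he⟩)

/-- **`B(SOS_{2^r}) ≤ 3·2^r·(4r+1)²·C(PERM_n)`** for `1 ≤ r`, `4r ≤ n`, every commutative ring.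
[cite: HrubesWigdersonYehudayoff2010, Cor. C.4, Lemma C.5] -/
theorem sos_bilinear_le_perm {r n s : ℕ} (hr : 1 ≤ r) (hn : 4 * r ≤ n)
    (h : HasNcCircuitSizeLE (ncPerPoly F n) s) :
    HWY10.bilinearComplexity F (HWY10.sosPoly F (2 ^ r)) ≤ 3 * 2 ^ r * (4 * r + 1) ^ 2 * s := by
  have h' := hasNcCircuitSizeLE_substIn (liftSubst F r n) h
  rw [perm_lift F hn] at h'
  exact sos_bilinear_le_lift F hr h'

end Subst

section Hardness

variable (K : Type u) [Field K]

/-- The analytic core of Theorem 1.7: `c·2^{(n-3)ε/4} ≤ 3(n+1)²·s` for every circuit of size `s`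
computing `PERM_n`, `n ≥ 4` (`r = ⌊n/4⌋` in `sos_bilinear_le_perm`). [cite: HrubesWigdersonYehudayoff2010, Thm 1.7] -/
theorem key_ineq {ε c : ℝ} (hε : 0 < ε) (hc : 0 < c)
    (hB : ∀ k : ℕ, c * (k : ℝ) ^ (1 + ε) ≤ (HWY10.bilinearComplexity K (HWY10.sosPoly K k) : ℝ))
    {n s : ℕ} (hn : 4 ≤ n) (hs : HasNcCircuitSizeLE (ncPerPoly K n) s) :
    c * (2 : ℝ) ^ (((n : ℝ) - 3) * ε / 4) ≤ 3 * ((n : ℝ) + 1) ^ 2 * s := by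
  obtain ⟨r, hr1, hrn, hnr⟩ : ∃ r : ℕ, 1 ≤ r ∧ 4 * r ≤ n ∧ n ≤ 4 * r + 3 :=
    ⟨n / 4, by omega, by omega, by omega⟩
  have hN : 3 * 2 ^ r * (4 * r + 1) ^ 2 * s ≤ 2 ^ r * (3 * (n + 1) ^ 2 * s) := by
    rw [show 3 * 2 ^ r * (4 * r + 1) ^ 2 * s = 2 ^ r * (3 * (4 * r + 1) ^ 2 * s) by ring]
    gcongr
  have h2r : (0 : ℝ) < (2 : ℝ) ^ r := by positivity
  have hsplit : ((2 ^ r : ℕ) : ℝ) ^ (1 + ε) = (2 : ℝ) ^ r * (2 : ℝ) ^ ((r : ℝ) * ε) := by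
    rw [Nat.cast_pow, Nat.cast_ofNat, Real.rpow_add h2r, Real.rpow_one,
      ← Real.rpow_natCast (2 : ℝ) r, ← Real.rpow_mul (by norm_num : (0 : ℝ) ≤ 2)]
  have hineq : (2 : ℝ) ^ r * (c * (2 : ℝ) ^ ((r : ℝ) * ε)) ≤
      (2 : ℝ) ^ r * (3 * ((n : ℝ) + 1) ^ 2 * s) :=
    calc (2 : ℝ) ^ r * (c * (2 : ℝ) ^ ((r : ℝ) * ε)) = c * ((2 ^ r : ℕ) : ℝ) ^ (1 + ε) := by
          rw [hsplit]; ring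
      _ ≤ _ := hB (2 ^ r)
      _ ≤ ((3 * 2 ^ r * (4 * r + 1) ^ 2 * s : ℕ) : ℝ) := by
          exact_mod_cast sos_bilinear_le_perm K hr1 hrn hs
      _ ≤ ((2 ^ r * (3 * (n + 1) ^ 2 * s) : ℕ) : ℝ) := by exact_mod_cast hN
      _ = (2 : ℝ) ^ r * (3 * ((n : ℝ) + 1) ^ 2 * s) := by push_cast; ring
  refine le_trans (mul_le_mul_of_nonneg_left (Real.rpow_le_rpow_of_exponent_le one_le_two ?_)
    hc.le) (le_of_mul_le_mul_left hineq h2r)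
  have hnr' : (n : ℝ) ≤ 4 * r + 3 := by exact_mod_cast hnr
  nlinarith [mul_le_mul_of_nonneg_right (show (n : ℝ) - 3 ≤ 4 * r by linarith) hε.le]

/-- **Hrubeš–Wigderson–Yehudayoff, Theorem 1.7, in the kernel**: the named fact `HWY10_thm_1_7 K`
for every field `K` — `B_K(SOS_k) ≥ c·k^{1+ε}` forces `2^n ≤ (s+1)^d`, `d = ⌈8/ε⌉₊`, for every size-`s`
fan-in-two noncommutative circuit computing `PERM_n`, all large `n`. [cite: HrubesWigdersonYehudayoff2010, Thm 1.7 (§C)] -/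
theorem HWY10_thm_1_7_holds : HWY10_thm_1_7 K := by
  rintro ⟨ε, hε, c, hc, hB⟩
  obtain ⟨d, hd⟩ : ∃ d : ℕ, (8 : ℝ) ≤ ε * d :=
    ⟨⌈8 / ε⌉₊, by rw [mul_comm]; exact (div_le_iff₀ hε).1 (Nat.le_ceil _)⟩
  have hK : (0 : ℝ) < c ^ d / (3 ^ d * 2 ^ 7) := by positivity
  obtain ⟨M, hM⟩ : ∃ M : ℕ, ∀ m ≥ M, (m : ℝ) ^ (2 * d) / 2 ^ m < c ^ d / (3 ^ d * 2 ^ 7) :=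
    Filter.eventually_atTop.1 ((tendsto_pow_const_div_const_pow_of_one_lt (2 * d)
      (one_lt_two : (1 : ℝ) < 2)).eventually (gt_mem_nhds hK))
  unfold HWY10.PermNcExpHard
  refine ⟨d, max M 4, fun n hn s hs => ?_⟩
  have hn4 : 4 ≤ n := le_of_max_le_right hn; have hkey := key_ineq K hε hc hB hn4 hs
  have ha : c ^ d * (2 : ℝ) ^ (2 * n - 6) ≤ (3 : ℝ) ^ d * ((n : ℝ) + 1) ^ (2 * d) * (s : ℝ) ^ d := by
    have hn3 : (3 : ℝ) ≤ n := by exact_mod_cast (show 3 ≤ n by omega)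
    have hexp : ((2 * n - 6 : ℕ) : ℝ) ≤ ((n : ℝ) - 3) * ε / 4 * d := by
      rw [Nat.cast_sub (by omega)]; push_cast
      nlinarith [mul_nonneg (sub_nonneg.2 hn3) (show (0 : ℝ) ≤ ε * d / 4 - 2 by linarith)]
    calc c ^ d * (2 : ℝ) ^ (2 * n - 6) = c ^ d * (2 : ℝ) ^ (((2 * n - 6 : ℕ)) : ℝ) := by
          rw [Real.rpow_natCast]
      _ ≤ c ^ d * ((2 : ℝ) ^ (((n : ℝ) - 3) * ε / 4)) ^ (d : ℝ) := by
          rw [← Real.rpow_mul (by norm_num : (0 : ℝ) ≤ 2)]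
          exact mul_le_mul_of_nonneg_left (Real.rpow_le_rpow_of_exponent_le one_le_two hexp)
            (by positivity)
      _ = (c * (2 : ℝ) ^ (((n : ℝ) - 3) * ε / 4)) ^ d := by rw [Real.rpow_natCast, mul_pow]
      _ ≤ (3 * ((n : ℝ) + 1) ^ 2 * s) ^ d := pow_le_pow_left₀ (by positivity) hkey d
      _ = (3 : ℝ) ^ d * ((n : ℝ) + 1) ^ (2 * d) * (s : ℝ) ^ d := by
          rw [mul_pow, mul_pow, ← pow_mul]
  have hb : (3 : ℝ) ^ d * ((n : ℝ) + 1) ^ (2 * d) * 2 ^ 6 < c ^ d * (2 : ℝ) ^ n := by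
    have hm := hM (n + 1) (((le_max_left M 4).trans hn).trans (Nat.le_succ n))
    rw [div_lt_div_iff₀ (by positivity) (by positivity)] at hm
    push_cast at hm
    refine lt_of_mul_lt_mul_right ?_ (zero_le_two : (0 : ℝ) ≤ 2)
    convert hm using 1 <;> ring
  have h2n : (2 : ℝ) ^ n * (2 : ℝ) ^ n = (2 : ℝ) ^ (2 * n - 6) * 2 ^ 6 := by
    rw [← pow_add, ← pow_add]; congr 1; omega
  have hle : c ^ d * (2 : ℝ) ^ n * (2 : ℝ) ^ n ≤ c ^ d * (2 : ℝ) ^ n * (s : ℝ) ^ d :=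
    calc c ^ d * (2 : ℝ) ^ n * (2 : ℝ) ^ n = c ^ d * (2 : ℝ) ^ (2 * n - 6) * 2 ^ 6 := by
          rw [mul_assoc, h2n, mul_assoc]
      _ ≤ (3 : ℝ) ^ d * ((n : ℝ) + 1) ^ (2 * d) * (s : ℝ) ^ d * 2 ^ 6 :=
          mul_le_mul_of_nonneg_right ha (by positivity)
      _ = (3 : ℝ) ^ d * ((n : ℝ) + 1) ^ (2 * d) * 2 ^ 6 * (s : ℝ) ^ d := by ring
      _ ≤ c ^ d * (2 : ℝ) ^ n * (s : ℝ) ^ d := mul_le_mul_of_nonneg_right hb.le (by positivity)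
  have hnat : (2 : ℝ) ^ n ≤ (s : ℝ) ^ d := le_of_mul_le_mul_left hle (by positivity)
  exact (by exact_mod_cast hnat : 2 ^ n ≤ s ^ d).trans (Nat.pow_le_pow_left (Nat.le_succ s) d)

end Hardness

end Summit.ValiantsHypothesis.ValiantsHypothesis.Theorems.NcSOSPermanent

end
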